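import Mathlib
import Summits.Ventures.HodgeRepro.Tier4.Common.MixedPlane
import Summits.Ventures.HodgeRepro.Tier4.Common.MixedPlaneKType
import Summits.Ventures.HodgeRepro.Tier4.Common.MixedPlaneCusp
import Summits.Ventures.HodgeRepro.Tier4.Common.AdelicRTF

/-!
# Tier4/Line4/TwoTorusCut — the typed CUT of the L4 wall `mixed_two_torus` into rungs W1 / W2 / W3, and the glue

Blind re-derivation cell `pub-hodge-repro`, Tier 4 «prove the step» (README §9–§10), seat t4-L4-p1 (lead g385 ruling
R-III, S12860: «a typed CUT of the wall into DEFINED rungs with displayed hypotheses (R1) — W1 the EXISTENCE of an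
irreducible cuspidal `V` with the two `K`-type clauses, W2 the non-zero `T′`-period, W3 the MIXED-PERIOD clause — and the
glue `W1 → W2 → W3 → mixed_two_torus` proved; L4-p1 = W1 + the glue»).  Tree path
`lean/Summits/Ventures/HodgeRepro/Tier4/Line4/TwoTorusCut.lean`.  GENERIC over any plane `W : PlaneData k` with RTF
data `R`; the wall (Line4/Skeleton v0.14 L399) is the instance `W := seesawPlane q a g g' …`, `w₀ := w₀ d`.

THE CUT (the wall's conclusion is `∃ V, <six spectral clauses> ∧ P_{χ′} ≠ 0 on V ∧ ∃ f ∈ V, f ≠ 0, χ̄′-equivariant,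
P_χ(f|_T) ≠ 0`):
* `IsAdmissible W q g g' w₀ eP eM eP' eM' V` — the SIX SPECTRAL CLAUSES: irreducible automorphic, cuspidal, the
  `K`-types `(eP w, eM w)` at every real place for the torus `T`, LOWEST at `w₀`, the same for the transported torus
  `T′` (the defined trace of «`V` is in the admissible spectrum of the seesaw plane at the prescribed archimedean type»).
* `IsRieszVector W R V f` — `f ∈ V`, `f ≠ 0`, `f(x t′) = χ̄′(t′) f(x)` for `t′ ∈ T′(𝔸)` (the `χ̄′`-equivariant vector =
  the Riesz vector of the `T′`-period functional, L4-MATH.md §11), NORMALISED `f 1 ≠ 0`.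
* `HasNonzeroMixedPeriod W R V` — some Riesz vector of `V` has a non-zero `T`-period against `χ`.
* **W1** (existence; the theta-lift construction `θ_{T′→U}(χ̄′)`, printed: Howe duality for `(U(1)×U(1), U(2))`, the
  archimedean `K`-types per Ichino Lemma 7.8 / `LitKType`): `∃ V, IsAdmissible … V ∧ ∃ f, IsRieszVector W R V f`.
* **W2** (PROVED here, Mathlib-level): a Riesz vector has a non-zero `T′`-period — `P_{χ′}(f|_{T′}) = vol(D_{T′}) · f 1`
  (`period_of_riesz`), so `HasNonzeroToricPeriod W R.μT' R.DT' R.chi' V` (`hasNonzeroToricPeriod_of_riesz`); DISPLAYED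
  hypotheses: `R.IsHaar` (positive finite volume of `D_{T′}`) and `hunit : ∀ t, ‖R.chi' t‖ = 1` (`χ′` UNITARY — NOT a
  field of `RTFData`; without it the integrand is `|χ′(t)|² f 1` and needs measurability of `χ′`, also absent:
  plan-4's to add to `RTFData` or to the wall's binders).
* **W3** (the simultaneous clause — the DECLARED WALL, narrowed: Michel–Ramakrishnan 2012 / Feigon–Whitehouse 2009 /
  the two-torus RTF of Jacquet 1987): `∃ V, IsAdmissible … V ∧ HasNonzeroMixedPeriod W R V`.  W3 ⇒ W1 trivially; W1 is
  the construction of the CANDIDATE `V`, W3 certifies its mixed period.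
* **GLUE** (PROVED): `exists_spectrum_of_rungs : R.IsHaar → hunit → W3 → <the wall's conclusion, verbatim shape>`,
  through W2.  So `mixed_two_torus = exists_spectrum_of_rungs hR hunit (W3 at the seesaw plane)`: the wall is EXACTLY
  W3 + the unitarity of `χ′`.

HC_CM is NOT proved by anyone in this repository.
-/

set_option autoImplicit false

noncomputable section

namespace Summit.Ventures.HodgeRepro.Tier4.Line4

open Summit.Ventures.HodgeRepro.Tier4.Common MeasureTheory NumberField

variable {k : Type} [Field k] [NumberField k] (W : PlaneData k)

/-- **The six spectral clauses of the wall**: `V` is an irreducible cuspidal automorphic subspace with the `K`-types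
`(eP w, eM w)` for `T` and `(eP' w, eM' w)` for the transported `T′` at every real place `w`, both LOWEST at `w₀` (no
`K`-type of difference `±1` with the same central character). -/
def IsAdmissible (q : QuadData k) (g g' : Matrix (Fin 4) (Fin 4) k) (w₀ : InfinitePlace k)
    (eP eM eP' eM' : InfinitePlace k → ℤ) (V : Submodule ℂ (GA W → ℂ)) : Prop :=
  IsIrreducibleAutomorphic W V ∧
  IsCuspidalSubspace W V ∧
  (∀ w, HasKTypeAt W q w (eP w) (eM w) V) ∧
  (∀ j : ℤ, |(eP w₀ - eM w₀) + 2 * j| < 3 → ¬ HasKTypeAt W q w₀ (eP w₀ + j) (eM w₀ - j) V) ∧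
  (∀ w, HasKTypeAt' W q w g g' (eP' w) (eM' w) V) ∧
  (∀ j : ℤ, |(eP' w₀ - eM' w₀) + 2 * j| < 3 → ¬ HasKTypeAt' W q w₀ g g' (eP' w₀ + j) (eM' w₀ - j) V)

variable [MeasurableSpace (torusT W)] [MeasurableSpace (torusT' W)] (R : RTFData W)

/-- **A Riesz vector of the `T′`-period on `V`**: `f ∈ V`, non-zero, `χ̄′`-equivariant under right translation by
`T′(𝔸)`, normalised by `f 1 ≠ 0`. -/
def IsRieszVector (V : Submodule ℂ (GA W → ℂ)) (f : GA W → ℂ) : Prop :=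
  f ∈ V ∧ f ≠ 0 ∧ (∀ (x : GA W) (t : torusT' W), f (x * t) = conjChar W R.chi' t * f x) ∧ f 1 ≠ 0

/-- **The mixed-period clause**: some Riesz vector of `V` has a non-zero `T`-period against `χ`. -/
def HasNonzeroMixedPeriod (V : Submodule ℂ (GA W → ℂ)) : Prop :=
  ∃ f, IsRieszVector W R V f ∧ periodLin W R.μT R.DT R.chi (restrictTo W (torusT W) f) ≠ 0

/-- `χ′(t) · χ̄′(t) = 1` for a unitary character. -/
theorem chi'_mul_conj (hunit : ∀ t, ‖R.chi' t‖ = 1) (t : torusT' W) :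
    R.chi' t * conjChar W R.chi' t = 1 := by
  unfold conjChar
  rw [Complex.mul_conj, Complex.normSq_eq_norm_sq, hunit t]
  simp

/-- **W2, the identity**: the `T′`-period of a `χ̄′`-equivariant function is `vol(D_{T′}) · f 1`. -/
theorem period_of_riesz (hR : R.IsHaar) (hunit : ∀ t, ‖R.chi' t‖ = 1) {f : GA W → ℂ}
    (hf : ∀ (x : GA W) (t : torusT' W), f (x * t) = conjChar W R.chi' t * f x) :
    periodLin W R.μT' R.DT' R.chi' (restrictTo W (torusT' W) f) = ((R.μT' R.DT').toReal : ℂ) * f 1 := by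
  have hconst : (fun t : torusT' W => R.chi' t * restrictTo W (torusT' W) f t) = fun _ => f 1 := by
    funext t
    unfold restrictTo
    rw [← one_mul (t : GA W), hf 1 t, ← mul_assoc, chi'_mul_conj W R hunit t, one_mul]
  haveI : IsFiniteMeasure (R.μT'.restrict R.DT') :=
    isFiniteMeasure_restrict.2 (ne_of_lt hR.2.2.2.2.2)
  rw [periodLin_eq_integral W R.μT' R.DT' R.chi' (by rw [hconst]; exact integrable_const _), hconst,
    setIntegral_const, Complex.real_smul]
  rfl

/-- **W2**: a Riesz vector witnesses the non-vanishing of the `T′`-period on `V`. -/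
theorem hasNonzeroToricPeriod_of_riesz (hR : R.IsHaar) (hunit : ∀ t, ‖R.chi' t‖ = 1)
    {V : Submodule ℂ (GA W → ℂ)} {f : GA W → ℂ} (hf : IsRieszVector W R V f) :
    HasNonzeroToricPeriod W R.μT' R.DT' R.chi' V := by
  refine ⟨f, hf.1, ?_⟩
  rw [period_of_riesz W R hR hunit hf.2.2.1]
  refine mul_ne_zero ?_ hf.2.2.2
  have hpos : 0 < (R.μT' R.DT').toReal :=
    ENNReal.toReal_pos (ne_of_gt hR.2.2.2.2.1) (ne_of_lt hR.2.2.2.2.2)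
  exact_mod_cast ne_of_gt hpos

/-- **THE GLUE `W3 → mixed_two_torus`** (through W2): from an admissible `V` with a non-zero mixed period, the wall's
conclusion in its verbatim shape — the six spectral clauses, `P_{χ′} ≠ 0` on `V`, and the `χ̄′`-equivariant `f ∈ V`
with non-zero `T`-period.  Displayed beyond the wall's binders: `hunit` (unitarity of `χ′`). -/
theorem exists_spectrum_of_rungs (hR : R.IsHaar) (hunit : ∀ t, ‖R.chi' t‖ = 1)
    (q : QuadData k) (g g' : Matrix (Fin 4) (Fin 4) k) (w₀ : InfinitePlace k)
    (eP eM eP' eM' : InfinitePlace k → ℤ)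
    (h3 : ∃ V : Submodule ℂ (GA W → ℂ), IsAdmissible W q g g' w₀ eP eM eP' eM' V ∧ HasNonzeroMixedPeriod W R V) :
    ∃ V : Submodule ℂ (GA W → ℂ),
      IsIrreducibleAutomorphic W V ∧
      IsCuspidalSubspace W V ∧
      (∀ w, HasKTypeAt W q w (eP w) (eM w) V) ∧
      (∀ j : ℤ, |(eP w₀ - eM w₀) + 2 * j| < 3 → ¬ HasKTypeAt W q w₀ (eP w₀ + j) (eM w₀ - j) V) ∧
      (∀ w, HasKTypeAt' W q w g g' (eP' w) (eM' w) V) ∧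
      (∀ j : ℤ, |(eP' w₀ - eM' w₀) + 2 * j| < 3 → ¬ HasKTypeAt' W q w₀ g g' (eP' w₀ + j) (eM' w₀ - j) V) ∧
      HasNonzeroToricPeriod W R.μT' R.DT' R.chi' V ∧
      ∃ f ∈ V, f ≠ 0 ∧
        (∀ (x : GA W) (t : torusT' W), f (x * t) = conjChar W R.chi' t * f x) ∧
        periodLin W R.μT R.DT R.chi (restrictTo W (torusT W) f) ≠ 0 := by
  obtain ⟨V, ⟨hirr, hcusp, hK, hlow, hK', hlow'⟩, f, hf, hmixed⟩ := h3
  exact ⟨V, hirr, hcusp, hK, hlow, hK', hlow', hasNonzeroToricPeriod_of_riesz W R hR hunit hf,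
    f, hf.1, hf.2.1, hf.2.2.1, hmixed⟩

/-- **W3 ⇒ W1** (the candidate of the construction is the `V` of the simultaneous clause). -/
theorem exists_admissible_riesz_of_mixed (q : QuadData k) (g g' : Matrix (Fin 4) (Fin 4) k) (w₀ : InfinitePlace k)
    (eP eM eP' eM' : InfinitePlace k → ℤ)
    (h3 : ∃ V : Submodule ℂ (GA W → ℂ), IsAdmissible W q g g' w₀ eP eM eP' eM' V ∧ HasNonzeroMixedPeriod W R V) :
    ∃ V : Submodule ℂ (GA W → ℂ), IsAdmissible W q g g' w₀ eP eM eP' eM' V ∧ ∃ f, IsRieszVector W R V f := by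
  obtain ⟨V, hV, f, hf, -⟩ := h3
  exact ⟨V, hV, f, hf⟩

end Summit.Ventures.HodgeRepro.Tier4.Line4

end
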